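import Literature.MathematicalPhysics.QuantumFieldTheory.Balaban1983to89.B9LeafXClassAntitone

/-!
# BalabanUVNodes ∕ N06 ([B9], `Dag.B9_main`) — THE FIVE CLASS AXIOMS OF THE R-GENERIC P-EDITION (edition 45, `…AtOpsYNuOfRecordV6EPairNZ`) ARE INHABITED
# AT PRINT'S CUBE CLASS: the sign-guarded, constant-blind families `R₁ := fun x _ α₀ U => 0 ≤ α₀ ∧ (bg9YP … x).Reg335 c35Y α₀ U`, `R₂` likewise

Track A of `YM-PLAN.md` (cell `pub-ymgap`, D-0062), node **N06** = [Balaban1985BackgroundPropagators] Thms 3.1–3.15; seat `pub-ymgap-dag-n06-d` (gen 14).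
WHY.  Edition 45 of the N06 certificate (this seat, `b9LeafXPR_opsYNuOfRecordV6E_pairNZ`) is typed over node00-def-Y's class-parametric carrier
`bg9YR 𝔸 G R₁ R₂` with the class `(R₁, R₂)` at threshold `c` identified with PRINT'S cube class (3.35)∕(3.36) at «O(1) = 10» (`c35Y`) by four displayed
inclusions and the membership `hGR`:
`hGR : MemOfFam SU(N) R₁`, `hRP1 : (bg9YR … R₁ R₂ x).Reg335 c α₀ U → 0 ≤ α₀ ∧ (bg9YP … x).Reg335 c35Y α₀ U`, `hRP2` (3.36), `hP1 : ClassIncl regYP335 c35Y R₁ c`,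
`hP2 : ClassIncl regYP336 c35Y R₂ c`.  This file records — so that the edition is NOT vacuous in its class axioms — that ALL FIVE hold, at every threshold `c`,
for the families `R₁ := fun x _ α₀ U => 0 ≤ α₀ ∧ (bg9YP 𝔸 G x).Reg335 c35Y α₀ U`, `R₂ := fun x _ α₀ U => 0 ≤ α₀ ∧ (bg9YP 𝔸 G x).Reg336 c35Y α₀ U`
(print's class at «10» read at every threshold, with the sign of α₀ that every printed statement carries anyway as `0 < α₀`): by `id`, `⟨hα.le, h⟩` and
MODULE 3-R's `memOfFam_regYP335`.  The families are given by displayed EQUATIONS (`h₁ h₂`, instantiated by `rfl`), so no definition is introduced.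
At these families and `c := c35B θ.ℓ₆` edition 45's remaining class-content reads are dag-n06-j's bridge (`regY335_of_regYP335`, inside the edition).
HONEST FRAMING.  Bookkeeping about hypothesis classes (three `id`s, one sign, one landed membership lemma); nothing of [B9] asserted; COUNT-NEUTRAL; N06 NOT
discharged; K1⁹ NOT closed; one finite 𝕋⁴ programme at fixed `ε` — NOT continuum ∕ OS ∕ mass gap ∕ Clay.  0 `def`, 0 `sorry`.
-/

noncomputable section

namespace Summit.QuantumFields.YangMills.BalabanUVNodes.N06PrintClassAxioms

open Literature.MathematicalPhysics.QuantumFieldTheory.Balaban1983to89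
open Literature.MathematicalPhysics.QuantumFieldTheory.Balaban1983to89.Node00 (Stage3Params)
open Literature.MathematicalPhysics.QuantumFieldTheory.Balaban1983to89.B9PinMembersKLevelV1 (MemberY)
open Literature.MathematicalPhysics.QuantumFieldTheory.Balaban1983to89.B9PinGeometryKLevelV1 (c35Y)
open Literature.MathematicalPhysics.QuantumFieldTheory.Balaban1983to89.B9BackgroundsKLevelV1P (bg9YP)
open Literature.MathematicalPhysics.QuantumFieldTheory.Balaban1983to89.B9BackgroundsKLevelV1R (RegFamY MemOfFam bg9YR regYP335 regYP336 memOfFam_regYP335)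
open Literature.MathematicalPhysics.QuantumFieldTheory.Balaban1983to89.B9LeafXClassAntitone (ClassIncl)
open Literature.MathematicalPhysics.QuantumFieldTheory.Balaban1983to89.B7Prop2SpecialUnitary (specialUnitaryUnits)
open scoped Matrix.Norms.L2Operator

variable {N : ℕ}

/-- ★ **THE FIVE CLASS AXIOMS OF EDITION 45 HOLD AT PRINT'S CUBE CLASS READ CONSTANT-BLIND WITH THE SIGN OF α₀** (module docstring): for the families given
by `h₁ h₂` and EVERY threshold `c`: membership in `SU(N)`, the two readings «the class IS (3.35)∕(3.36) at O(1) = 10» (by `id`), and the two guarded converse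
inclusions `ClassIncl regYP33x c35Y Rₓ c` (by the sign). [cite: Balaban1985BackgroundPropagators, (3.35)–(3.36) p.396 («U with values in G», «O(1) … ≧ 10»), Thm 3.1 p.397 («0 < α₀»)] -/
theorem printClass_axioms (θ : Stage3Params) (Mstar : ℕ) (R₁ R₂ : RegFamY θ.d₆ θ.ℓ₆ θ.hd' θ.hL' θ.b₀ θ.b₁ Mstar (Matrix (Fin N) (Fin N) ℂ))
    (h₁ : R₁ = fun x _ α₀ U => 0 ≤ α₀ ∧ (bg9YP (Matrix (Fin N) (Fin N) ℂ) (specialUnitaryUnits (Fin N)) x).Reg335 c35Y α₀ U)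
    (h₂ : R₂ = fun x _ α₀ U => 0 ≤ α₀ ∧ (bg9YP (Matrix (Fin N) (Fin N) ℂ) (specialUnitaryUnits (Fin N)) x).Reg336 c35Y α₀ U) (c : ℝ) :
    MemOfFam (specialUnitaryUnits (Fin N)) R₁ ∧
    (∀ (x : MemberY θ.d₆ θ.ℓ₆ θ.hd' θ.hL' θ.b₀ θ.b₁ Mstar) (α₀ : ℝ) (U : (bg9YR (Matrix (Fin N) (Fin N) ℂ) (specialUnitaryUnits (Fin N)) R₁ R₂ x).Cfg),
      (bg9YR (Matrix (Fin N) (Fin N) ℂ) (specialUnitaryUnits (Fin N)) R₁ R₂ x).Reg335 c α₀ U →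
        0 ≤ α₀ ∧ (bg9YP (Matrix (Fin N) (Fin N) ℂ) (specialUnitaryUnits (Fin N)) x).Reg335 c35Y α₀ U) ∧
    (∀ (x : MemberY θ.d₆ θ.ℓ₆ θ.hd' θ.hL' θ.b₀ θ.b₁ Mstar) (α₀ : ℝ) (U : (bg9YR (Matrix (Fin N) (Fin N) ℂ) (specialUnitaryUnits (Fin N)) R₁ R₂ x).Cfg),
      (bg9YR (Matrix (Fin N) (Fin N) ℂ) (specialUnitaryUnits (Fin N)) R₁ R₂ x).Reg336 c α₀ U →
        0 ≤ α₀ ∧ (bg9YP (Matrix (Fin N) (Fin N) ℂ) (specialUnitaryUnits (Fin N)) x).Reg336 c35Y α₀ U) ∧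
    ClassIncl (regYP335 (Matrix (Fin N) (Fin N) ℂ) (specialUnitaryUnits (Fin N))) c35Y R₁ c ∧
    ClassIncl (regYP336 (Matrix (Fin N) (Fin N) ℂ) (specialUnitaryUnits (Fin N))) c35Y R₂ c := by
  subst h₁ h₂
  exact ⟨fun x _ α₀ U h => memOfFam_regYP335 x c35Y α₀ U h.2, fun x α₀ U h => h, fun x α₀ U h => h, fun x α₀ U hα h => ⟨hα.le, h⟩,
    fun x α₀ U hα h => ⟨hα.le, h⟩⟩

end Summit.QuantumFields.YangMills.BalabanUVNodes.N06PrintClassAxioms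

end
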